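import Summits.QuantumFields.BalabanUV.Beta.EriceRemainderEnclosureHistoryAutonomyComparisonChainCriterion
import Summits.QuantumFields.BalabanUV.Beta.EriceRemainderEnclosureHistoryAutonomyComparisonGreedyDualChain

/-!
# EriceRemainderEnclosureHistoryAutonomyComparisonDualChainCriterion — (E65f) THE DUAL CHAIN CRITERION: `B(u) = b + Σ_{k<K} L_k·u_k` (ANY finite age set
# `A ⊆ [1,K[`, sizes and Markov weight ARBITRARY) compares at any size under every isotone excess as soon as, for every load vector `x ≥ 0` on `A` inside
# the WINDOW BUDGET of (E65a), the DUAL CHAIN of (E65e) closes: along the ages in increasing order, with `a_k = 4k⁻k∕(k+k⁻)²`, `r_k = k⁻∕k`,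
# `e_k = min(a_kμ_{k⁻}, 2λ_{k⁻}r_k)`: **`x_k(e_k + 3∕4) < 1`**, `μ_k(1 − x_k(3∕4 + e_k)) ≥ e_k(1 + x_k) + 3x_k∕4`, `λ_k(1 − x_k(3∕4 + e_k)) ≥
# λ_{k⁻}r_k(1 + x_k∕4) + x_k(1 + e_k)` (`μ_{m₀}(1 − 3x∕4) ≥ 3x∕4`, `λ_{m₀}(1 − 3x∕4) ≥ x` at the youngest age).  (E65b) ∘ (E65e).  This is the form of
# route (C″) that survives tall dense towers: numerically the condition value stays `≤ 0.26` on uniform towers of ratios `2 … 10` to height `150` and never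
# exceeds the lone-age term `3x∕4 ≤ 0.53` on anything searched (README) — conjecture (E58′) for finite profiles is the inequality «window budget ⟹ dual
# chain» between explicit elementary functions of the ages and loads

Cell `pub-balaban`, β-function sub-cell, BINDER row D4 «RemainderConst leaves for Bałaban's split» (`HOME/BINDER-OWNERS.md`; owner lineage `b2b-balaban-beta-an4`;
this file by co-owner #2 lineage `b2b-balaban-beta-d4-p2`, generation 58), β-FLOW TEAM duty (1), FREEZE (0) honoured (def-free; (E65b)'s
`le_of_isotone_excess_budgeted_certificate`, (E65e)'s `certificate_of_dual_chain`, (E65d)'s `load_le_sqrt_two_div_two_of_budget` BY NAME; nothing restated).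

HONEST FRAMING (page 1, verbatim and binding).  *"Discharging BetaPertH makes Bałaban's UV stability UNCONDITIONAL — a real constructive-QFT result; it is
NOT the continuum limit and NOT the Clay problem."*  THIS FILE DISCHARGES NOTHING OF THE KIND.  Elementary real analysis about ABSTRACT affine functionals on a
box ]0,γ]^ℕ with displayed supports and signs — hypotheses of a census, not facts; the form, signs, ages and moments of Bałaban's (1.22) limit functional are
NOT PRINTED ([I] p. 298; GAPS G-t4-U2-1∕-2) and NOT asserted.  Row D4 class UNCHANGED (critical-path width 0; instance 0∕1; D4 DISCHARGE NO DATE).  HONEST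
DEPENDENCY: continuum YM on T⁴ ⇐ BetaPertH ∧ nine spine estimates (0/9 proved); BetaPertH ⇐ (D1) ∧ (D4) ∧ CAP+tail; G-an2-4 gates asym, D1 and NE2/3/4.

THE POINT (census sense (α); the COMPARISON column, conjecture (E58′)).  (E65d) reduced (E58′) to «budget ⟹ μ-chain»; that implication is FALSE for tall
towers of small ratio (README `chain3.py`: ratio `2`, uniform budgeted load `0.098`, the μ-chain's condition value passes `1` before height `20` with the
factor `a_k`, before height `80` with the sharp one-step factor) although the LP itself keeps room `1.69` there — the one-step transport compounds
`(8∕9)^Δ` where the true defect decays like `2^{−Δ}`.  The dual chain repairs exactly this with the age-weighted potential (far-field transport `2s∕k`, no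
compounding), and keeps the one-step potential for clusters.  The remaining inequality is between the window weights `S_{k,j}∕max(k,j)` and the chain maps
above; its numerical margin is a factor `≈ 1.9` uniformly.  NOT CLAIMED: that inequality (OPEN); anything printed.

WHAT IS PROVED ([folklore]; 0 `def`, 0 sorry).  **`le_of_isotone_excess_of_budgeted_dual_chain`** (END).
-/
noncomputable section
open Finset Set

namespace Summit.QuantumFields.BalabanUV.Beta.EriceRemainderEnclosureHistoryAutonomyComparisonDualChainCriterion

open Literature.MathematicalPhysics.QuantumFieldTheory.Balaban1983to89
open Literature.MathematicalPhysics.QuantumFieldTheory.Balaban1983to89.T4BetaStationary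
open Literature.MathematicalPhysics.QuantumFieldTheory.Balaban1983to89.T4BetaFlowWellPosed
open Summit.QuantumFields.BalabanUV.Beta.EriceRemainderEnclosureHistoryAutonomyComparisonBudgetedCriterion (le_of_isotone_excess_budgeted_certificate)
open Summit.QuantumFields.BalabanUV.Beta.EriceRemainderEnclosureHistoryAutonomyComparisonChainCriterion (load_le_sqrt_two_div_two_of_budget)
open Summit.QuantumFields.BalabanUV.Beta.EriceRemainderEnclosureHistoryAutonomyComparisonGreedyDualChain (certificate_of_dual_chain)

variable {B' : (ℕ → ℝ) → ℝ} {M' γ b : ℝ} {L : ℕ → ℝ} {K : ℕ} {A : Finset ℕ} {h h' : ℕ → ℝ}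

/-- **THE DUAL CHAIN CRITERION.**  `B(u) = b + Σ_{k<K} L_k·u_k` on ]0,γ] (`b > 0`, `L ≥ 0` supported on `{0} ∪ A`, `A ⊆ [1,K[` ANY finite set of ages with
minimum `m₀` and predecessor map `pred`; sizes and Markov weight ARBITRARY).  Suppose that for EVERY load vector `x ≥ 0` on `A` obeying (E58b)'s profile bound
and (E65a)'s window budget at every scale `j ≥ 1` there are chain values `μ, λ ≥ 0` on `A` closing the DUAL CHAIN of (E65e): `μ_{m₀}(1 − 3x_{m₀}∕4) ≥
3x_{m₀}∕4`, `λ_{m₀}(1 − 3x_{m₀}∕4) ≥ x_{m₀}`, and for `k ≠ m₀` in `A`, with `a_k = 4·pred k·k∕(k + pred k)²`, `r_k = pred k∕k`, `e_k = min(a_kμ_{pred k},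
2λ_{pred k}r_k)`: **`x_k(e_k + 3∕4) < 1`**, `μ_k(1 − x_k(3∕4 + e_k)) ≥ e_k(1 + x_k) + 3x_k∕4`, `λ_k(1 − x_k(3∕4 + e_k)) ≥ λ_{pred k}r_k(1 + x_k∕4) + x_k(1 + e_k)`.
Then for every `B′ ≥ B` with a zeroth moment and an ISOTONE excess, ANY box solutions from one pin satisfy `h′ ≤ h` at EVERY scale — (E65b) with the
certificate of (E65e) (`3x_{m₀}∕4 < 1` from the budget, (E65d) §1). [folklore] -/
theorem le_of_isotone_excess_of_budgeted_dual_chain {p : ℝ} {pred : ℕ → ℕ} {m₀ : ℕ} (hL : ∀ k, 0 ≤ L k) (hb : 0 < b) (hAK : A ⊆ range K)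
    (hA1 : ∀ k ∈ A, 1 ≤ k) (hsupp : ∀ k ∈ range K, k ∉ A → k ≠ 0 → L k = 0) (hm₀ : m₀ ∈ A) (hmin : ∀ k ∈ A, m₀ ≤ k)
    (hpred : ∀ k ∈ A, k ≠ m₀ → pred k ∈ A ∧ pred k < k ∧ ∀ k'' ∈ A, k'' < k → k'' ≤ pred k)
    (hchain : ∀ x : ℕ → ℝ, (∀ k ∈ A, 0 ≤ x k) →
      (∀ k ∈ A, x k ≤ L k / (2 * ∑ k' ∈ range K, L k' * Real.sqrt ((k : ℝ) / ((k : ℝ) + k')))) →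
      (∀ j : ℕ, 1 ≤ j → ∑ k ∈ A, x k *
        (if k ≤ j then (∑ l ∈ range j, Real.sqrt ((k : ℝ) / ((k : ℝ) + l + 1))) / j
          else (∑ l ∈ range j, Real.sqrt ((k : ℝ) / ((k : ℝ) + l + 1))) / k) ≤ 1 / 2) →
      ∃ μ lam : ℕ → ℝ, (∀ k ∈ A, 0 ≤ μ k) ∧ (∀ k ∈ A, 0 ≤ lam k) ∧
        3 / 4 * x m₀ ≤ μ m₀ * (1 - 3 / 4 * x m₀) ∧ x m₀ ≤ lam m₀ * (1 - 3 / 4 * x m₀) ∧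
        (∀ k ∈ A, k ≠ m₀ →
          x k * (min (4 * (pred k : ℝ) * k / ((k : ℝ) + pred k) ^ 2 * μ (pred k)) (2 * lam (pred k) * ((pred k : ℝ) / k)) + 3 / 4) < 1) ∧
        (∀ k ∈ A, k ≠ m₀ →
          min (4 * (pred k : ℝ) * k / ((k : ℝ) + pred k) ^ 2 * μ (pred k)) (2 * lam (pred k) * ((pred k : ℝ) / k)) * (1 + x k) + 3 / 4 * x k ≤
            μ k * (1 - x k * (3 / 4 + min (4 * (pred k : ℝ) * k / ((k : ℝ) + pred k) ^ 2 * μ (pred k)) (2 * lam (pred k) * ((pred k : ℝ) / k))))) ∧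
        (∀ k ∈ A, k ≠ m₀ →
          lam (pred k) * ((pred k : ℝ) / k) * (1 + x k / 4) +
              x k * (1 + min (4 * (pred k : ℝ) * k / ((k : ℝ) + pred k) ^ 2 * μ (pred k)) (2 * lam (pred k) * ((pred k : ℝ) / k))) ≤
            lam k * (1 - x k * (3 / 4 + min (4 * (pred k : ℝ) * k / ((k : ℝ) + pred k) ^ 2 * μ (pred k)) (2 * lam (pred k) * ((pred k : ℝ) / k))))))
    (hB' : ∀ u u' : ℕ → ℝ, SeqBox γ u → SeqBox γ u' → ∀ D : ℝ, (∀ j, |u j - u' j| ≤ D) → |B' u - B' u'| ≤ M' * D) (hM' : 0 ≤ M')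
    (hexc : ∀ u, SeqBox γ u → (fun u : ℕ → ℝ => b + ∑ k ∈ range K, L k * u k) u ≤ B' u)
    (hDmono : ∀ u v : ℕ → ℝ, SeqBox γ u → SeqBox γ v → (∀ j, u j ≤ v j) →
      B' u - (fun u : ℕ → ℝ => b + ∑ k ∈ range K, L k * u k) u ≤ B' v - (fun u : ℕ → ℝ => b + ∑ k ∈ range K, L k * u k) v)
    (hp : 0 < p) (hpγ : p ≤ γ) (hh : SeqBox γ h) (hf : MemFlow (fun u : ℕ → ℝ => b + ∑ k ∈ range K, L k * u k) p h)
    (hh' : SeqBox γ h') (hf' : MemFlow B' p h') (j : ℕ) : h' j ≤ h j := by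
  refine le_of_isotone_excess_budgeted_certificate hL hb hAK hA1 hsupp (fun x hx hP hbud => ?_) hB' hM' hexc hDmono hp hpγ hh hf hh' hf' j
  obtain ⟨μ, lam, hμ, hlam, hμ₀, hlam₀, hcond, hrecμ, hrecL⟩ := hchain x hx hP hbud
  have hx₀ : 3 / 4 * x m₀ < 1 := by
    have h1 := load_le_sqrt_two_div_two_of_budget hx hm₀ (hA1 m₀ hm₀) (hbud m₀ (hA1 m₀ hm₀))
    have h2 : Real.sqrt 2 < 2 := by
      have h3 : Real.sqrt 2 < Real.sqrt (2 ^ 2) := Real.sqrt_lt_sqrt (by norm_num) (by norm_num)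
      rwa [Real.sqrt_sq (by norm_num : (0 : ℝ) ≤ 2)] at h3
    linarith
  exact certificate_of_dual_chain hA1 hx hm₀ hmin hpred hμ hlam hx₀ hμ₀ hlam₀ hcond hrecμ hrecL

end Summit.QuantumFields.BalabanUV.Beta.EriceRemainderEnclosureHistoryAutonomyComparisonDualChainCriterion

end
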